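import Summits.QuantumFields.BalabanUV.Beta.NVertexGradedRecordLetters
import Summits.QuantumFields.BalabanUV.Beta.NVertexEvenCarrierTorus

/-!
# `BalabanUV.Beta.NVertexGradedRecordTorus` — row D1 ∕ (C1) OWNER «beta-an2», PART 94, v11 (T1) ∕ v10G: **THE WOUND EVEN GRADED N-FAMILY ON THE TORUS IS THREE WORDS, AND ON
# THE FIELD–FIELD BLOCK ITS BI-VERTEX TABLE IS `cE₂ ·` THE WOUND EVEN WILSON BI-STENCIL** — PART 22's `dper_tsum_WN_evenHalf` and PART 23 (`perF_dper_tsum_WN_evenHalf`,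
# `perF_W2SymOfK_N_even`, `perF_W2OfK_N_even`, `perF_vertex2OfK_N_even`, `perF_mixOfK_N_even`, `perF_T2N_even_per_inl_inl`, **`perF_dper_wound_WN_evenHalf_inl_inl_eq_sum`**)
# AT THE GRADED RECORD `tabsCompG` (PART 92), the N-system's second-order family written out as `WchartOf (fun _ => compChart …) (tabsCompG (j+1) …) (P.cE (j+1)) … (P.T (j+1)) 0`
# — THE DISPLAYED READING `hWNff` THAT `TowerHN2Row.hHN2_of_locks_of_junctions_of_reading` CONSUMES, with the two mixed words AT `compMixG` = v11's `hM₂′` text (token for token)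

WHY (journal [AN2-G84-W-2] l.69137 (A)(B), [AN2-G84-W-3] l.69139): the graded twin of the row's PART 23 for the road's `hHN₂` chain under (T1) (and for v10G ∕ (O3)).  Proofs = the
originals' character for character over PART 93's graded letters (`gen84/rec-g84/port93.py`, token map `tabsComp ↦ tabsCompG`, `WN R P j ↦ WchartOf … (tabsCompG …) … 0`, names `…G`).

WHAT ([folklore] bookkeeping BY NAME; no `def`, no `def … : Prop`, nothing cited, 0 sorry): §1 `dper_tsum_WNG_evenHalf`, `periodCov_M2NG_even`; §2 `perF_dper_tsum_WNG_evenHalf`,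
`perF_W2SymOfK_NG_even`, `perF_W2OfK_NG_even`, `perF_vertex2OfK_NG_even`, `perF_mixOfK_NG_even`; §3 `perF_T2NG_even_per_inl_inl`; §4 **`perF_dper_wound_WNG_evenHalf_inl_inl_eq_sum`**.
WHAT THIS IS NOT: not the H-side word `H₂f`, not its junction rows, not the door (which under (T1) becomes `WNG − WN`, FINDING AN2-84-1 — NOT typed here), not `hX′`, not the END;
v10's PART 22∕23 UNTOUCHED; nothing of Bałaban's asserted, valued or discharged; 0 estimates; 0∕4 row-D1 binders (hW, hR, D1Tel, D1Rep); ROOT M‴ p325680 ∕ P5c ∕ D6 untouched;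
NOT (C1), NOT (T-ID), NOT D1, NEVER «G-an2-4 closed», NOT BetaPertH, NOT continuum, NOT Clay.

HONEST DEPENDENCY (page 1, mandatory): continuum YM on T⁴ ⇐ BetaPertH ∧ nine spine estimates (0/9 proved); BetaPertH ⇐ (D1) ∧ (D4) ∧ CAP+tail;
G-an2-4 gates asym, D1 and NE2/3/4.  HONEST FRAMING (cell contract, verbatim): «discharging `BetaPertH` makes Bałaban's UV stability UNCONDITIONAL —
a real constructive-QFT result; it is NOT the continuum limit and NOT the Clay problem.»  ABSOLUTE RULE (cell charter, verbatim): «No internally-minted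
statement may enter as a cited fact. Every hypothesis is either kernel-proved in this package or a verbatim quotation of a PUBLISHED theorem with page
reference. The manuscript(s) under audit are NOT citable for their own disputed steps — they are the thing under adjudication; programme-internal
(2001/route/tribunal) claims are never citable.»  Row D1 ∕ (C1) OWNER «beta-an2», b2b-balaban-beta-an2 gen 84, 2026-08-29.  No existing file touched.
-/

noncomputable section

open scoped BigOperators

namespace Summit.QuantumFields.BalabanUV.Beta.NVertexGradedRecord

open Finset Matrix
open Literature.MathematicalPhysics.QuantumFieldTheory
open Literature.MathematicalPhysics.QuantumFieldTheory.Balaban1983to89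
open Literature.MathematicalPhysics.QuantumFieldTheory.Balaban1983to89.Beta
open Finset
open B6Lemma24Torus (pbox)
open ExpKernelCalculus (MKer Decays)
open AffineAveraging (Site box)
open OneStepResolventKernel (Fib)
open SecondOrderResponse (vertex2OfK mixOfK W2OfK W2SymOfK)
open WilsonBiStencil (wilsonW₂)
open BalabanStepW2 (M2Of)
open Summit.QuantumFields.BalabanUV.Beta.AxialDressingRooted (one_le_of_neZero)
open Summit.QuantumFields.BalabanUV.Beta.SpineRooted (SpureRecOf T2RecOf)
open Summit.QuantumFields.BalabanUV.Beta.ChartStepJets (WchartOf)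
open Summit.QuantumFields.BalabanUV.Beta.CompositeCorrectorDress (compChart)
open Summit.QuantumFields.BalabanUV.Beta.CompositeOneShotJetData (Roots Pins AN AN_eq WN)
open Summit.QuantumFields.BalabanUV.Beta.FP.KernelPeriodisationFib (Idx perF perF_add perF_smul)
open Summit.QuantumFields.BalabanUV.Beta.FP.KernelPeriodisationFibLoc (dper)
open B4TorusKernel.MultiPeriod (translate)
open Summit.QuantumFields.BalabanUV.Beta.FP.TorusGaugeCovariancePairing (wrapPt)
open Summit.QuantumFields.BalabanUV.Beta.CombHId2FoldsSlots (perF_vertex2OfK_csf_per perF_mixOfK_cs_per decays_vertex2OfK_csf_per decays_mixOfK_cs_per)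
open Summit.QuantumFields.BalabanUV.Beta.CombHId2TorusSym (perF_W2SymOfK_slots decays_add_min)
open Summit.QuantumFields.BalabanUV.Beta.NVertexWoundPeriodised (decays_AN_family)
open Summit.QuantumFields.BalabanUV.Beta.TameKernelCalculus (trK)
open Summit.QuantumFields.BalabanUV.Beta.BorderedHessian (sgnK)
open HessKerRate (biLoc_zero)
open Summit.QuantumFields.BalabanUV.Beta.NVertexEvenCarrier (W2OfK_zero_first)
open Summit.QuantumFields.BalabanUV.Beta.FP.PeriodisedBorderTables (dper_smul)
open Summit.QuantumFields.BalabanUV.Beta.NVertexWoundTorus (translate_inv_AN)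
open Summit.QuantumFields.BalabanUV.Beta.NVertexEvenBorderTorus (perF_dper_apply_congr_entry)
open Summit.QuantumFields.BalabanUV.Beta.NVertexEvenCarrierPeriodised (dper_zero)
open Summit.QuantumFields.BalabanUV.Beta.CompositeOneShotJetsGraded (tabsCompG)
open Summit.QuantumFields.BalabanUV.Beta.NVertexEvenCarrierTorus (sum₄_mul_pull)

variable {Lc : ℕ} [NeZero Lc] (R : Roots Lc) (P : Pins) (j : ℕ) (M : Fin (3 + 1) → ℕ) [∀ μ, NeZero (M μ)] {M' : Fin (3 + 1) → ℕ}

section WithM'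

variable [∀ μ, NeZero (M' μ)]

omit [∀ μ, NeZero (M' μ)] in
/-- [folklore] **`perF_dper_tsum_WNG_evenHalf`** — the torus matrix of the wound EVEN N-family IS `perF M (W2SymOfK (AN R j) N 0 0 T2Eᵖᵉʳ M2Eᵖᵉʳ …)` (PART 22 under `perF M`). -/
theorem perF_dper_tsum_WNG_evenHalf (hM : ∀ i, M i = Lc ^ (j + 1) * M' i) (μ : Fin (3 + 1)) (y : Site (3 + 1)) (ν : Fin (3 + 1)) (y' : Site (3 + 1)) :
    perF M (dper M (fun x w a b => ∑' e : Site (3 + 1),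
        ((1 / 2 : ℝ) • ((WchartOf (fun _ => compChart R.rc Lc (j + 1) (R.s (j + 1)) (Lc ^ (j + 1))) (tabsCompG (j + 1) (one_le_of_neZero Lc) R.hr (P.cM (j + 1))) (P.cE (j + 1)) (P.cVH (j + 1)) (P.cΛ (j + 1)) (P.cE₂ (j + 1)) (P.cB (j + 1)) (P.T (j + 1)) 0) μ y ν (translate M' y' e) + sgnK (trK ((WchartOf (fun _ => compChart R.rc Lc (j + 1) (R.s (j + 1)) (Lc ^ (j + 1))) (tabsCompG (j + 1) (one_le_of_neZero Lc) R.hr (P.cM (j + 1))) (P.cE (j + 1)) (P.cVH (j + 1)) (P.cΛ (j + 1)) (P.cE₂ (j + 1)) (P.cB (j + 1)) (P.T (j + 1)) 0) μ y ν (translate M' y' e))))) x w a b))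
      = perF M (W2SymOfK (AN R j) (Lc ^ (j + 1)) (0 : Fin (3 + 1) → (Fin (3 + 1) → ℤ) → MKer (3 + 1) (Fib 3)) (0 : Fin (3 + 1) → (Fin (3 + 1) → ℤ) → MKer (3 + 1) (Fib 3))
          (fun κ u κ' u' => dper M (fun x z a c => ∑' n : Site (3 + 1),
            ((1 / 2 : ℝ) • (T2RecOf 3 (Lc ^ (j + 1)) (fun _ => compChart R.rc Lc (j + 1) (R.s (j + 1)) (Lc ^ (j + 1)))
        (SpureRecOf 3 (Lc ^ (j + 1)) (tabsCompG (j + 1) (one_le_of_neZero Lc) R.hr (P.cM (j + 1))).V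
        (tabsCompG (j + 1) (one_le_of_neZero Lc) R.hr (P.cM (j + 1))).H (fun _ => compChart R.rc Lc (j + 1) (R.s (j + 1)) (Lc ^ (j + 1)))
        (P.cE (j + 1)) (P.cVH (j + 1)) (P.cΛ (j + 1)))
        (tabsCompG (j + 1) (one_le_of_neZero Lc) R.hr (P.cM (j + 1))).M (P.cE₂ (j + 1)) (P.cB (j + 1)) (P.T (j + 1))
        (tabsCompG (j + 1) (one_le_of_neZero Lc) R.hr (P.cM (j + 1))).vh₂S (tabsCompG (j + 1) (one_le_of_neZero Lc) R.hr (P.cM (j + 1))).mixFF 0 κ u κ' (translate M u' n)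
          + sgnK (trK (T2RecOf 3 (Lc ^ (j + 1)) (fun _ => compChart R.rc Lc (j + 1) (R.s (j + 1)) (Lc ^ (j + 1)))
        (SpureRecOf 3 (Lc ^ (j + 1)) (tabsCompG (j + 1) (one_le_of_neZero Lc) R.hr (P.cM (j + 1))).V
        (tabsCompG (j + 1) (one_le_of_neZero Lc) R.hr (P.cM (j + 1))).H (fun _ => compChart R.rc Lc (j + 1) (R.s (j + 1)) (Lc ^ (j + 1)))
        (P.cE (j + 1)) (P.cVH (j + 1)) (P.cΛ (j + 1)))
        (tabsCompG (j + 1) (one_le_of_neZero Lc) R.hr (P.cM (j + 1))).M (P.cE₂ (j + 1)) (P.cB (j + 1)) (P.T (j + 1))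
        (tabsCompG (j + 1) (one_le_of_neZero Lc) R.hr (P.cM (j + 1))).vh₂S (tabsCompG (j + 1) (one_le_of_neZero Lc) R.hr (P.cM (j + 1))).mixFF 0 κ u κ' (translate M u' n))))) x z a c))
          (fun κ u ρ w => dper M (fun x z a c => ∑' n : Site (3 + 1),
            ((1 / 2 : ℝ) • (M2Of 3 (Lc ^ (j + 1)) (tabsCompG (j + 1) (one_le_of_neZero Lc) R.hr (P.cM (j + 1))).mixFF 0 κ u ρ (translate M' w n) + sgnK (trK (M2Of 3 (Lc ^ (j + 1)) (tabsCompG (j + 1) (one_le_of_neZero Lc) R.hr (P.cM (j + 1))).mixFF 0 κ u ρ (translate M' w n))))) x z a c)) μ y ν y') := by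
  rw [dper_tsum_WNG_evenHalf R P j M hM μ y ν y']

/-- [folklore] **`perF_W2SymOfK_NG_even` — `Ŵ♮` SPLITS BY ORIENTATION**: `perF M (W2SymOfK (AN) N 0 0 T2Eᵖᵉʳ M2Eᵖᵉʳ b b′) = ½•(perF M (W2OfK … b b′) + perF M (W2OfK … b′ b))`
(`CombHId2TorusSym.perF_W2SymOfK_slots` at the ZERO first-order sockets and PART 22's even-table letters; `dper_zero` restores the literal `0 0`). -/
theorem perF_W2SymOfK_NG_even (hM : ∀ i, M i = Lc ^ (j + 1) * M' i) (μ : Fin (3 + 1)) (y : Site (3 + 1)) (ν : Fin (3 + 1)) (y' : Site (3 + 1)) :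
    perF M (W2SymOfK (AN R j) (Lc ^ (j + 1)) (0 : Fin (3 + 1) → (Fin (3 + 1) → ℤ) → MKer (3 + 1) (Fib 3)) (0 : Fin (3 + 1) → (Fin (3 + 1) → ℤ) → MKer (3 + 1) (Fib 3))
          (fun κ u κ' u' => dper M (fun x z a c => ∑' n : Site (3 + 1),
            ((1 / 2 : ℝ) • (T2RecOf 3 (Lc ^ (j + 1)) (fun _ => compChart R.rc Lc (j + 1) (R.s (j + 1)) (Lc ^ (j + 1)))
        (SpureRecOf 3 (Lc ^ (j + 1)) (tabsCompG (j + 1) (one_le_of_neZero Lc) R.hr (P.cM (j + 1))).V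
        (tabsCompG (j + 1) (one_le_of_neZero Lc) R.hr (P.cM (j + 1))).H (fun _ => compChart R.rc Lc (j + 1) (R.s (j + 1)) (Lc ^ (j + 1)))
        (P.cE (j + 1)) (P.cVH (j + 1)) (P.cΛ (j + 1)))
        (tabsCompG (j + 1) (one_le_of_neZero Lc) R.hr (P.cM (j + 1))).M (P.cE₂ (j + 1)) (P.cB (j + 1)) (P.T (j + 1))
        (tabsCompG (j + 1) (one_le_of_neZero Lc) R.hr (P.cM (j + 1))).vh₂S (tabsCompG (j + 1) (one_le_of_neZero Lc) R.hr (P.cM (j + 1))).mixFF 0 κ u κ' (translate M u' n)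
          + sgnK (trK (T2RecOf 3 (Lc ^ (j + 1)) (fun _ => compChart R.rc Lc (j + 1) (R.s (j + 1)) (Lc ^ (j + 1)))
        (SpureRecOf 3 (Lc ^ (j + 1)) (tabsCompG (j + 1) (one_le_of_neZero Lc) R.hr (P.cM (j + 1))).V
        (tabsCompG (j + 1) (one_le_of_neZero Lc) R.hr (P.cM (j + 1))).H (fun _ => compChart R.rc Lc (j + 1) (R.s (j + 1)) (Lc ^ (j + 1)))
        (P.cE (j + 1)) (P.cVH (j + 1)) (P.cΛ (j + 1)))
        (tabsCompG (j + 1) (one_le_of_neZero Lc) R.hr (P.cM (j + 1))).M (P.cE₂ (j + 1)) (P.cB (j + 1)) (P.T (j + 1))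
        (tabsCompG (j + 1) (one_le_of_neZero Lc) R.hr (P.cM (j + 1))).vh₂S (tabsCompG (j + 1) (one_le_of_neZero Lc) R.hr (P.cM (j + 1))).mixFF 0 κ u κ' (translate M u' n))))) x z a c))
          (fun κ u ρ w => dper M (fun x z a c => ∑' n : Site (3 + 1),
            ((1 / 2 : ℝ) • (M2Of 3 (Lc ^ (j + 1)) (tabsCompG (j + 1) (one_le_of_neZero Lc) R.hr (P.cM (j + 1))).mixFF 0 κ u ρ (translate M' w n) + sgnK (trK (M2Of 3 (Lc ^ (j + 1)) (tabsCompG (j + 1) (one_le_of_neZero Lc) R.hr (P.cM (j + 1))).mixFF 0 κ u ρ (translate M' w n))))) x z a c)) μ y ν y')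
      = (1 / 2 : ℝ) • (perF M (W2OfK (AN R j) (Lc ^ (j + 1)) (0 : Fin (3 + 1) → (Fin (3 + 1) → ℤ) → MKer (3 + 1) (Fib 3)) (0 : Fin (3 + 1) → (Fin (3 + 1) → ℤ) → MKer (3 + 1) (Fib 3))
            (fun κ u κ' u' => dper M (fun x z a c => ∑' n : Site (3 + 1),
            ((1 / 2 : ℝ) • (T2RecOf 3 (Lc ^ (j + 1)) (fun _ => compChart R.rc Lc (j + 1) (R.s (j + 1)) (Lc ^ (j + 1)))
        (SpureRecOf 3 (Lc ^ (j + 1)) (tabsCompG (j + 1) (one_le_of_neZero Lc) R.hr (P.cM (j + 1))).V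
        (tabsCompG (j + 1) (one_le_of_neZero Lc) R.hr (P.cM (j + 1))).H (fun _ => compChart R.rc Lc (j + 1) (R.s (j + 1)) (Lc ^ (j + 1)))
        (P.cE (j + 1)) (P.cVH (j + 1)) (P.cΛ (j + 1)))
        (tabsCompG (j + 1) (one_le_of_neZero Lc) R.hr (P.cM (j + 1))).M (P.cE₂ (j + 1)) (P.cB (j + 1)) (P.T (j + 1))
        (tabsCompG (j + 1) (one_le_of_neZero Lc) R.hr (P.cM (j + 1))).vh₂S (tabsCompG (j + 1) (one_le_of_neZero Lc) R.hr (P.cM (j + 1))).mixFF 0 κ u κ' (translate M u' n)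
          + sgnK (trK (T2RecOf 3 (Lc ^ (j + 1)) (fun _ => compChart R.rc Lc (j + 1) (R.s (j + 1)) (Lc ^ (j + 1)))
        (SpureRecOf 3 (Lc ^ (j + 1)) (tabsCompG (j + 1) (one_le_of_neZero Lc) R.hr (P.cM (j + 1))).V
        (tabsCompG (j + 1) (one_le_of_neZero Lc) R.hr (P.cM (j + 1))).H (fun _ => compChart R.rc Lc (j + 1) (R.s (j + 1)) (Lc ^ (j + 1)))
        (P.cE (j + 1)) (P.cVH (j + 1)) (P.cΛ (j + 1)))
        (tabsCompG (j + 1) (one_le_of_neZero Lc) R.hr (P.cM (j + 1))).M (P.cE₂ (j + 1)) (P.cB (j + 1)) (P.T (j + 1))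
        (tabsCompG (j + 1) (one_le_of_neZero Lc) R.hr (P.cM (j + 1))).vh₂S (tabsCompG (j + 1) (one_le_of_neZero Lc) R.hr (P.cM (j + 1))).mixFF 0 κ u κ' (translate M u' n))))) x z a c))
            (fun κ u ρ w => dper M (fun x z a c => ∑' n : Site (3 + 1),
            ((1 / 2 : ℝ) • (M2Of 3 (Lc ^ (j + 1)) (tabsCompG (j + 1) (one_le_of_neZero Lc) R.hr (P.cM (j + 1))).mixFF 0 κ u ρ (translate M' w n) + sgnK (trK (M2Of 3 (Lc ^ (j + 1)) (tabsCompG (j + 1) (one_le_of_neZero Lc) R.hr (P.cM (j + 1))).mixFF 0 κ u ρ (translate M' w n))))) x z a c)) μ y ν y')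
          + perF M (W2OfK (AN R j) (Lc ^ (j + 1)) (0 : Fin (3 + 1) → (Fin (3 + 1) → ℤ) → MKer (3 + 1) (Fib 3)) (0 : Fin (3 + 1) → (Fin (3 + 1) → ℤ) → MKer (3 + 1) (Fib 3))
            (fun κ u κ' u' => dper M (fun x z a c => ∑' n : Site (3 + 1),
            ((1 / 2 : ℝ) • (T2RecOf 3 (Lc ^ (j + 1)) (fun _ => compChart R.rc Lc (j + 1) (R.s (j + 1)) (Lc ^ (j + 1)))
        (SpureRecOf 3 (Lc ^ (j + 1)) (tabsCompG (j + 1) (one_le_of_neZero Lc) R.hr (P.cM (j + 1))).V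
        (tabsCompG (j + 1) (one_le_of_neZero Lc) R.hr (P.cM (j + 1))).H (fun _ => compChart R.rc Lc (j + 1) (R.s (j + 1)) (Lc ^ (j + 1)))
        (P.cE (j + 1)) (P.cVH (j + 1)) (P.cΛ (j + 1)))
        (tabsCompG (j + 1) (one_le_of_neZero Lc) R.hr (P.cM (j + 1))).M (P.cE₂ (j + 1)) (P.cB (j + 1)) (P.T (j + 1))
        (tabsCompG (j + 1) (one_le_of_neZero Lc) R.hr (P.cM (j + 1))).vh₂S (tabsCompG (j + 1) (one_le_of_neZero Lc) R.hr (P.cM (j + 1))).mixFF 0 κ u κ' (translate M u' n)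
          + sgnK (trK (T2RecOf 3 (Lc ^ (j + 1)) (fun _ => compChart R.rc Lc (j + 1) (R.s (j + 1)) (Lc ^ (j + 1)))
        (SpureRecOf 3 (Lc ^ (j + 1)) (tabsCompG (j + 1) (one_le_of_neZero Lc) R.hr (P.cM (j + 1))).V
        (tabsCompG (j + 1) (one_le_of_neZero Lc) R.hr (P.cM (j + 1))).H (fun _ => compChart R.rc Lc (j + 1) (R.s (j + 1)) (Lc ^ (j + 1)))
        (P.cE (j + 1)) (P.cVH (j + 1)) (P.cΛ (j + 1)))
        (tabsCompG (j + 1) (one_le_of_neZero Lc) R.hr (P.cM (j + 1))).M (P.cE₂ (j + 1)) (P.cB (j + 1)) (P.T (j + 1))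
        (tabsCompG (j + 1) (one_le_of_neZero Lc) R.hr (P.cM (j + 1))).vh₂S (tabsCompG (j + 1) (one_le_of_neZero Lc) R.hr (P.cM (j + 1))).mixFF 0 κ u κ' (translate M u' n))))) x z a c))
            (fun κ u ρ w => dper M (fun x z a c => ∑' n : Site (3 + 1),
            ((1 / 2 : ℝ) • (M2Of 3 (Lc ^ (j + 1)) (tabsCompG (j + 1) (one_le_of_neZero Lc) R.hr (P.cM (j + 1))).mixFF 0 κ u ρ (translate M' w n) + sgnK (trK (M2Of 3 (Lc ^ (j + 1)) (tabsCompG (j + 1) (one_le_of_neZero Lc) R.hr (P.cM (j + 1))).mixFF 0 κ u ρ (translate M' w n))))) x z a c)) ν y' μ y)) := by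
  obtain ⟨δG, CG, hδG, -, hG⟩ := decays_AN_family R j 0
  obtain ⟨C₂, δ₂, hδ₂, hS₂⟩ := exists_locStencil₂_T2NG_even R P j
  obtain ⟨Cm, δm, hδm, hM₂⟩ := exists_locStencilFM_M2NG_even R P j (one_le_of_neZero Lc)
  have h := perF_W2SymOfK_slots M hM (translate_inv_AN R j M hM) (by rw [AN_eq]; exact hG) hδG
    (S := (0 : Fin (3 + 1) → (Fin (3 + 1) → ℤ) → MKer (3 + 1) (Fib 3))) (fun _ _ _ _ _ _ _ => rfl) (fun κ u => biLoc_zero _ _ (1 : ℝ)) one_pos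
    (Mt := (0 : Fin (3 + 1) → (Fin (3 + 1) → ℤ) → MKer (3 + 1) (Fib 3))) (fun _ _ _ _ _ _ _ => rfl) (fun _ _ => biLoc_zero _ _ (1 : ℝ)) one_pos
    (T2NG_even_translate R P j) hS₂ hδ₂ (periodCov_M2NG_even R P j M (one_le_of_neZero Lc) hM) hM₂ hδm μ y ν y'
  simp only [Pi.zero_apply, dper_zero] at h
  exact h

/-- [folklore] **`perF_W2OfK_NG_even` — THE THREE TORUS WORDS OF THE EVEN FAMILY** (no response word): `perF M (W2OfK (AN) N 0 0 T2Eᵖᵉʳ M2Eᵖᵉʳ b b′)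
= perF M (vertex2OfK (AN) N T2Eᵖᵉʳ b b′) + perF M (mixOfK (AN) N M2Eᵖᵉʳ b b′) + perF M (mixOfK (AN) N M2Eᵖᵉʳ b′ b)` (PART 21 `W2OfK_zero_first` + `perF_add` on the decaying words). -/
theorem perF_W2OfK_NG_even (hM : ∀ i, M i = Lc ^ (j + 1) * M' i) (μ : Fin (3 + 1)) (y : Site (3 + 1)) (ν : Fin (3 + 1)) (y' : Site (3 + 1)) :
    perF M (W2OfK (AN R j) (Lc ^ (j + 1)) (0 : Fin (3 + 1) → (Fin (3 + 1) → ℤ) → MKer (3 + 1) (Fib 3)) (0 : Fin (3 + 1) → (Fin (3 + 1) → ℤ) → MKer (3 + 1) (Fib 3))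
          (fun κ u κ' u' => dper M (fun x z a c => ∑' n : Site (3 + 1),
            ((1 / 2 : ℝ) • (T2RecOf 3 (Lc ^ (j + 1)) (fun _ => compChart R.rc Lc (j + 1) (R.s (j + 1)) (Lc ^ (j + 1)))
        (SpureRecOf 3 (Lc ^ (j + 1)) (tabsCompG (j + 1) (one_le_of_neZero Lc) R.hr (P.cM (j + 1))).V
        (tabsCompG (j + 1) (one_le_of_neZero Lc) R.hr (P.cM (j + 1))).H (fun _ => compChart R.rc Lc (j + 1) (R.s (j + 1)) (Lc ^ (j + 1)))
        (P.cE (j + 1)) (P.cVH (j + 1)) (P.cΛ (j + 1)))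
        (tabsCompG (j + 1) (one_le_of_neZero Lc) R.hr (P.cM (j + 1))).M (P.cE₂ (j + 1)) (P.cB (j + 1)) (P.T (j + 1))
        (tabsCompG (j + 1) (one_le_of_neZero Lc) R.hr (P.cM (j + 1))).vh₂S (tabsCompG (j + 1) (one_le_of_neZero Lc) R.hr (P.cM (j + 1))).mixFF 0 κ u κ' (translate M u' n)
          + sgnK (trK (T2RecOf 3 (Lc ^ (j + 1)) (fun _ => compChart R.rc Lc (j + 1) (R.s (j + 1)) (Lc ^ (j + 1)))
        (SpureRecOf 3 (Lc ^ (j + 1)) (tabsCompG (j + 1) (one_le_of_neZero Lc) R.hr (P.cM (j + 1))).V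
        (tabsCompG (j + 1) (one_le_of_neZero Lc) R.hr (P.cM (j + 1))).H (fun _ => compChart R.rc Lc (j + 1) (R.s (j + 1)) (Lc ^ (j + 1)))
        (P.cE (j + 1)) (P.cVH (j + 1)) (P.cΛ (j + 1)))
        (tabsCompG (j + 1) (one_le_of_neZero Lc) R.hr (P.cM (j + 1))).M (P.cE₂ (j + 1)) (P.cB (j + 1)) (P.T (j + 1))
        (tabsCompG (j + 1) (one_le_of_neZero Lc) R.hr (P.cM (j + 1))).vh₂S (tabsCompG (j + 1) (one_le_of_neZero Lc) R.hr (P.cM (j + 1))).mixFF 0 κ u κ' (translate M u' n))))) x z a c))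
          (fun κ u ρ w => dper M (fun x z a c => ∑' n : Site (3 + 1),
            ((1 / 2 : ℝ) • (M2Of 3 (Lc ^ (j + 1)) (tabsCompG (j + 1) (one_le_of_neZero Lc) R.hr (P.cM (j + 1))).mixFF 0 κ u ρ (translate M' w n) + sgnK (trK (M2Of 3 (Lc ^ (j + 1)) (tabsCompG (j + 1) (one_le_of_neZero Lc) R.hr (P.cM (j + 1))).mixFF 0 κ u ρ (translate M' w n))))) x z a c)) μ y ν y')
      = perF M (vertex2OfK (AN R j) (Lc ^ (j + 1))
            (fun κ u κ' u' => dper M (fun x z a c => ∑' n : Site (3 + 1),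
            ((1 / 2 : ℝ) • (T2RecOf 3 (Lc ^ (j + 1)) (fun _ => compChart R.rc Lc (j + 1) (R.s (j + 1)) (Lc ^ (j + 1)))
        (SpureRecOf 3 (Lc ^ (j + 1)) (tabsCompG (j + 1) (one_le_of_neZero Lc) R.hr (P.cM (j + 1))).V
        (tabsCompG (j + 1) (one_le_of_neZero Lc) R.hr (P.cM (j + 1))).H (fun _ => compChart R.rc Lc (j + 1) (R.s (j + 1)) (Lc ^ (j + 1)))
        (P.cE (j + 1)) (P.cVH (j + 1)) (P.cΛ (j + 1)))
        (tabsCompG (j + 1) (one_le_of_neZero Lc) R.hr (P.cM (j + 1))).M (P.cE₂ (j + 1)) (P.cB (j + 1)) (P.T (j + 1))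
        (tabsCompG (j + 1) (one_le_of_neZero Lc) R.hr (P.cM (j + 1))).vh₂S (tabsCompG (j + 1) (one_le_of_neZero Lc) R.hr (P.cM (j + 1))).mixFF 0 κ u κ' (translate M u' n)
          + sgnK (trK (T2RecOf 3 (Lc ^ (j + 1)) (fun _ => compChart R.rc Lc (j + 1) (R.s (j + 1)) (Lc ^ (j + 1)))
        (SpureRecOf 3 (Lc ^ (j + 1)) (tabsCompG (j + 1) (one_le_of_neZero Lc) R.hr (P.cM (j + 1))).V
        (tabsCompG (j + 1) (one_le_of_neZero Lc) R.hr (P.cM (j + 1))).H (fun _ => compChart R.rc Lc (j + 1) (R.s (j + 1)) (Lc ^ (j + 1)))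
        (P.cE (j + 1)) (P.cVH (j + 1)) (P.cΛ (j + 1)))
        (tabsCompG (j + 1) (one_le_of_neZero Lc) R.hr (P.cM (j + 1))).M (P.cE₂ (j + 1)) (P.cB (j + 1)) (P.T (j + 1))
        (tabsCompG (j + 1) (one_le_of_neZero Lc) R.hr (P.cM (j + 1))).vh₂S (tabsCompG (j + 1) (one_le_of_neZero Lc) R.hr (P.cM (j + 1))).mixFF 0 κ u κ' (translate M u' n))))) x z a c)) μ y ν y')
        + perF M (mixOfK (AN R j) (Lc ^ (j + 1))
            (fun κ u ρ w => dper M (fun x z a c => ∑' n : Site (3 + 1),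
            ((1 / 2 : ℝ) • (M2Of 3 (Lc ^ (j + 1)) (tabsCompG (j + 1) (one_le_of_neZero Lc) R.hr (P.cM (j + 1))).mixFF 0 κ u ρ (translate M' w n) + sgnK (trK (M2Of 3 (Lc ^ (j + 1)) (tabsCompG (j + 1) (one_le_of_neZero Lc) R.hr (P.cM (j + 1))).mixFF 0 κ u ρ (translate M' w n))))) x z a c)) μ y ν y')
        + perF M (mixOfK (AN R j) (Lc ^ (j + 1))
            (fun κ u ρ w => dper M (fun x z a c => ∑' n : Site (3 + 1),
            ((1 / 2 : ℝ) • (M2Of 3 (Lc ^ (j + 1)) (tabsCompG (j + 1) (one_le_of_neZero Lc) R.hr (P.cM (j + 1))).mixFF 0 κ u ρ (translate M' w n) + sgnK (trK (M2Of 3 (Lc ^ (j + 1)) (tabsCompG (j + 1) (one_le_of_neZero Lc) R.hr (P.cM (j + 1))).mixFF 0 κ u ρ (translate M' w n))))) x z a c)) ν y' μ y) := by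
  obtain ⟨δG, CG, hδG, -, hG⟩ := decays_AN_family R j 0
  obtain ⟨C₂, δ₂, hδ₂, hS₂⟩ := exists_locStencil₂_T2NG_even R P j
  obtain ⟨Cm, δm, hδm, hM₂⟩ := exists_locStencilFM_M2NG_even R P j (one_le_of_neZero Lc)
  have hK : Decays (AN R j) CG δG := by rw [AN_eq]; exact hG
  obtain ⟨C1, -, h1⟩ := decays_vertex2OfK_csf_per M hM (translate_inv_AN R j M hM) hK hδG (T2NG_even_translate R P j) hS₂ hδ₂ μ y ν y'
  obtain ⟨C2, -, h2⟩ := decays_mixOfK_cs_per M hM (translate_inv_AN R j M hM) hK hδG (periodCov_M2NG_even R P j M (one_le_of_neZero Lc) hM) hM₂ hδm μ y ν y'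
  obtain ⟨C3, -, h3⟩ := decays_mixOfK_cs_per M hM (translate_inv_AN R j M hM) hK hδG (periodCov_M2NG_even R P j M (one_le_of_neZero Lc) hM) hM₂ hδm ν y' μ y
  rw [W2OfK_zero_first, perF_add M (decays_add_min h1 h2) h3 (lt_min (half_pos hδ₂) (half_pos hδm)) (half_pos hδm),
    perF_add M h1 h2 (half_pos hδ₂) (half_pos hδm)]

omit [∀ μ, NeZero (M' μ)] in
/-- [folklore] **THE BI-VERTEX WORD OF THE EVEN FAMILY** (road (H)'s `colN̂·colN̂` shape; `CombHId2FoldsSlots.perF_vertex2OfK_csf_per` at the even table):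
`perF M (vertex2OfK (AN) N T2Eᵖᵉʳ μ y ν y′) P Q = Σ_{u,κ} Σ_{u′,κ′} Θ(u,κ;μ,y) · (Θ(u′,κ′;ν,y′) · perF M (T2Eᵖᵉʳ κ u κ′ u′) P Q)`. -/
theorem perF_vertex2OfK_NG_even (hM : ∀ i, M i = Lc ^ (j + 1) * M' i) (μ : Fin (3 + 1)) (y : Site (3 + 1)) (ν : Fin (3 + 1)) (y' : Site (3 + 1)) (X Z : Idx M (Fib 3)) :
    perF M (vertex2OfK (AN R j) (Lc ^ (j + 1))
            (fun κ u κ' u' => dper M (fun x z a c => ∑' n : Site (3 + 1),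
            ((1 / 2 : ℝ) • (T2RecOf 3 (Lc ^ (j + 1)) (fun _ => compChart R.rc Lc (j + 1) (R.s (j + 1)) (Lc ^ (j + 1)))
        (SpureRecOf 3 (Lc ^ (j + 1)) (tabsCompG (j + 1) (one_le_of_neZero Lc) R.hr (P.cM (j + 1))).V
        (tabsCompG (j + 1) (one_le_of_neZero Lc) R.hr (P.cM (j + 1))).H (fun _ => compChart R.rc Lc (j + 1) (R.s (j + 1)) (Lc ^ (j + 1)))
        (P.cE (j + 1)) (P.cVH (j + 1)) (P.cΛ (j + 1)))
        (tabsCompG (j + 1) (one_le_of_neZero Lc) R.hr (P.cM (j + 1))).M (P.cE₂ (j + 1)) (P.cB (j + 1)) (P.T (j + 1))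
        (tabsCompG (j + 1) (one_le_of_neZero Lc) R.hr (P.cM (j + 1))).vh₂S (tabsCompG (j + 1) (one_le_of_neZero Lc) R.hr (P.cM (j + 1))).mixFF 0 κ u κ' (translate M u' n)
          + sgnK (trK (T2RecOf 3 (Lc ^ (j + 1)) (fun _ => compChart R.rc Lc (j + 1) (R.s (j + 1)) (Lc ^ (j + 1)))
        (SpureRecOf 3 (Lc ^ (j + 1)) (tabsCompG (j + 1) (one_le_of_neZero Lc) R.hr (P.cM (j + 1))).V
        (tabsCompG (j + 1) (one_le_of_neZero Lc) R.hr (P.cM (j + 1))).H (fun _ => compChart R.rc Lc (j + 1) (R.s (j + 1)) (Lc ^ (j + 1)))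
        (P.cE (j + 1)) (P.cVH (j + 1)) (P.cΛ (j + 1)))
        (tabsCompG (j + 1) (one_le_of_neZero Lc) R.hr (P.cM (j + 1))).M (P.cE₂ (j + 1)) (P.cB (j + 1)) (P.T (j + 1))
        (tabsCompG (j + 1) (one_le_of_neZero Lc) R.hr (P.cM (j + 1))).vh₂S (tabsCompG (j + 1) (one_le_of_neZero Lc) R.hr (P.cM (j + 1))).mixFF 0 κ u κ' (translate M u' n))))) x z a c)) μ y ν y') X Z
      = ∑ u : ↥(pbox M), ∑ κ : Fin (3 + 1), ∑ u' : ↥(pbox M), ∑ κ' : Fin (3 + 1),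
          perF M (AN R j) (u, Sum.inl κ) (wrapPt M (((Lc ^ (j + 1) : ℕ) : ℤ) • y), Sum.inr μ)
            * (perF M (AN R j) (u', Sum.inl κ') (wrapPt M (((Lc ^ (j + 1) : ℕ) : ℤ) • y'), Sum.inr ν)
                * perF M (dper M (fun x z a c => ∑' n : Site (3 + 1),
            ((1 / 2 : ℝ) • (T2RecOf 3 (Lc ^ (j + 1)) (fun _ => compChart R.rc Lc (j + 1) (R.s (j + 1)) (Lc ^ (j + 1)))
        (SpureRecOf 3 (Lc ^ (j + 1)) (tabsCompG (j + 1) (one_le_of_neZero Lc) R.hr (P.cM (j + 1))).V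
        (tabsCompG (j + 1) (one_le_of_neZero Lc) R.hr (P.cM (j + 1))).H (fun _ => compChart R.rc Lc (j + 1) (R.s (j + 1)) (Lc ^ (j + 1)))
        (P.cE (j + 1)) (P.cVH (j + 1)) (P.cΛ (j + 1)))
        (tabsCompG (j + 1) (one_le_of_neZero Lc) R.hr (P.cM (j + 1))).M (P.cE₂ (j + 1)) (P.cB (j + 1)) (P.T (j + 1))
        (tabsCompG (j + 1) (one_le_of_neZero Lc) R.hr (P.cM (j + 1))).vh₂S (tabsCompG (j + 1) (one_le_of_neZero Lc) R.hr (P.cM (j + 1))).mixFF 0 κ (u : Site (3 + 1)) κ' (translate M (u' : Site (3 + 1)) n)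
          + sgnK (trK (T2RecOf 3 (Lc ^ (j + 1)) (fun _ => compChart R.rc Lc (j + 1) (R.s (j + 1)) (Lc ^ (j + 1)))
        (SpureRecOf 3 (Lc ^ (j + 1)) (tabsCompG (j + 1) (one_le_of_neZero Lc) R.hr (P.cM (j + 1))).V
        (tabsCompG (j + 1) (one_le_of_neZero Lc) R.hr (P.cM (j + 1))).H (fun _ => compChart R.rc Lc (j + 1) (R.s (j + 1)) (Lc ^ (j + 1)))
        (P.cE (j + 1)) (P.cVH (j + 1)) (P.cΛ (j + 1)))
        (tabsCompG (j + 1) (one_le_of_neZero Lc) R.hr (P.cM (j + 1))).M (P.cE₂ (j + 1)) (P.cB (j + 1)) (P.T (j + 1))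
        (tabsCompG (j + 1) (one_le_of_neZero Lc) R.hr (P.cM (j + 1))).vh₂S (tabsCompG (j + 1) (one_le_of_neZero Lc) R.hr (P.cM (j + 1))).mixFF 0 κ (u : Site (3 + 1)) κ' (translate M (u' : Site (3 + 1)) n))))) x z a c)) X Z) := by
  obtain ⟨δG, CG, hδG, -, hG⟩ := decays_AN_family R j 0
  obtain ⟨C₂, δ₂, hδ₂, hS₂⟩ := exists_locStencil₂_T2NG_even R P j
  exact perF_vertex2OfK_csf_per M hM (translate_inv_AN R j M hM) (by rw [AN_eq]; exact hG) hδG (T2NG_even_translate R P j) hS₂ hδ₂ μ y ν y' X Z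

/-- [folklore] **THE MIXED WORD OF THE EVEN FAMILY** (either bond order; ONE `Θ`-column, ONE `Ŝ`-column; `CombHId2FoldsSlots.perF_mixOfK_cs_per` at the even table):
`perF M (mixOfK (AN) N M2Eᵖᵉʳ μ y ν y′) P Q = Σ_{u,κ} Σ_{w∈pbox M′,ρ} Θ(u,κ;μ,y) · (Ŝ(w,ρ;ν,y′) · perF M (M2Eᵖᵉʳ κ u ρ w) P Q)`. -/
theorem perF_mixOfK_NG_even (hM : ∀ i, M i = Lc ^ (j + 1) * M' i) (μ : Fin (3 + 1)) (y : Site (3 + 1)) (ν : Fin (3 + 1)) (y' : Site (3 + 1)) (X Z : Idx M (Fib 3)) :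
    perF M (mixOfK (AN R j) (Lc ^ (j + 1))
            (fun κ u ρ w => dper M (fun x z a c => ∑' n : Site (3 + 1),
            ((1 / 2 : ℝ) • (M2Of 3 (Lc ^ (j + 1)) (tabsCompG (j + 1) (one_le_of_neZero Lc) R.hr (P.cM (j + 1))).mixFF 0 κ u ρ (translate M' w n) + sgnK (trK (M2Of 3 (Lc ^ (j + 1)) (tabsCompG (j + 1) (one_le_of_neZero Lc) R.hr (P.cM (j + 1))).mixFF 0 κ u ρ (translate M' w n))))) x z a c)) μ y ν y') X Z
      = ∑ u : ↥(pbox M), ∑ κ : Fin (3 + 1), ∑ w : ↥(pbox M'), ∑ ρ : Fin (3 + 1),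
          perF M (AN R j) (u, Sum.inl κ) (wrapPt M (((Lc ^ (j + 1) : ℕ) : ℤ) • y), Sum.inr μ)
            * (perF M (AN R j) (wrapPt M (((Lc ^ (j + 1) : ℕ) : ℤ) • (w : Site (3 + 1))), Sum.inr ρ) (wrapPt M (((Lc ^ (j + 1) : ℕ) : ℤ) • y'), Sum.inr ν)
                * perF M (dper M (fun x z a c => ∑' n : Site (3 + 1),
            ((1 / 2 : ℝ) • (M2Of 3 (Lc ^ (j + 1)) (tabsCompG (j + 1) (one_le_of_neZero Lc) R.hr (P.cM (j + 1))).mixFF 0 κ (u : Site (3 + 1)) ρ (translate M' (w : Site (3 + 1)) n) + sgnK (trK (M2Of 3 (Lc ^ (j + 1)) (tabsCompG (j + 1) (one_le_of_neZero Lc) R.hr (P.cM (j + 1))).mixFF 0 κ (u : Site (3 + 1)) ρ (translate M' (w : Site (3 + 1)) n))))) x z a c)) X Z) := by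
  obtain ⟨δG, CG, hδG, -, hG⟩ := decays_AN_family R j 0
  obtain ⟨Cm, δm, hδm, hM₂⟩ := exists_locStencilFM_M2NG_even R P j (one_le_of_neZero Lc)
  exact perF_mixOfK_cs_per M hM (translate_inv_AN R j M hM) (by rw [AN_eq]; exact hG) hδG (periodCov_M2NG_even R P j M (one_le_of_neZero Lc) hM) hM₂ hδm μ y ν y' X Z

end WithM'

omit [∀ μ, NeZero (M μ)] in
/-- [folklore] **`perF_T2NG_even_per_inl_inl` — on `(inl α, inl β)` the wound-periodised even table `T2Eᵖᵉʳ` is `cE₂ ·` the wound-periodised EVEN WILSON BI-STENCIL**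
(PART 21 `T2NG_even_apply_inl_inl` under `Σ'_n` by `tsum_congr` + `tsum_mul_left` — no summability —, `perF ∘ dper` fibre-entrywise by PART 20 `perF_dper_apply_congr_entry`,
`dper_smul ∕ perF_smul`). -/
theorem perF_T2NG_even_per_inl_inl (κ : Fin (3 + 1)) (u : Site (3 + 1)) (κ' : Fin (3 + 1)) (u' : Site (3 + 1)) (p q : ↥(pbox M)) (α β : Fin (3 + 1)) :
    perF M (dper M (fun x z a c => ∑' n : Site (3 + 1),
            ((1 / 2 : ℝ) • (T2RecOf 3 (Lc ^ (j + 1)) (fun _ => compChart R.rc Lc (j + 1) (R.s (j + 1)) (Lc ^ (j + 1)))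
        (SpureRecOf 3 (Lc ^ (j + 1)) (tabsCompG (j + 1) (one_le_of_neZero Lc) R.hr (P.cM (j + 1))).V
        (tabsCompG (j + 1) (one_le_of_neZero Lc) R.hr (P.cM (j + 1))).H (fun _ => compChart R.rc Lc (j + 1) (R.s (j + 1)) (Lc ^ (j + 1)))
        (P.cE (j + 1)) (P.cVH (j + 1)) (P.cΛ (j + 1)))
        (tabsCompG (j + 1) (one_le_of_neZero Lc) R.hr (P.cM (j + 1))).M (P.cE₂ (j + 1)) (P.cB (j + 1)) (P.T (j + 1))
        (tabsCompG (j + 1) (one_le_of_neZero Lc) R.hr (P.cM (j + 1))).vh₂S (tabsCompG (j + 1) (one_le_of_neZero Lc) R.hr (P.cM (j + 1))).mixFF 0 κ u κ' (translate M u' n)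
          + sgnK (trK (T2RecOf 3 (Lc ^ (j + 1)) (fun _ => compChart R.rc Lc (j + 1) (R.s (j + 1)) (Lc ^ (j + 1)))
        (SpureRecOf 3 (Lc ^ (j + 1)) (tabsCompG (j + 1) (one_le_of_neZero Lc) R.hr (P.cM (j + 1))).V
        (tabsCompG (j + 1) (one_le_of_neZero Lc) R.hr (P.cM (j + 1))).H (fun _ => compChart R.rc Lc (j + 1) (R.s (j + 1)) (Lc ^ (j + 1)))
        (P.cE (j + 1)) (P.cVH (j + 1)) (P.cΛ (j + 1)))
        (tabsCompG (j + 1) (one_le_of_neZero Lc) R.hr (P.cM (j + 1))).M (P.cE₂ (j + 1)) (P.cB (j + 1)) (P.T (j + 1))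
        (tabsCompG (j + 1) (one_le_of_neZero Lc) R.hr (P.cM (j + 1))).vh₂S (tabsCompG (j + 1) (one_le_of_neZero Lc) R.hr (P.cM (j + 1))).mixFF 0 κ u κ' (translate M u' n))))) x z a c)) (p, Sum.inl α) (q, Sum.inl β)
      = P.cE₂ (j + 1) * perF M (dper M (fun x z a c => ∑' n : Site (3 + 1),
            ((1 / 2 : ℝ) • (wilsonW₂ 3 (P.T (j + 1)) κ u κ' (translate M u' n) + sgnK (trK (wilsonW₂ 3 (P.T (j + 1)) κ u κ' (translate M u' n))))) x z a c)) (p, Sum.inl α) (q, Sum.inl β) := by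
  have hY : ∀ x w : Site (3 + 1),
      (fun x z a c => ∑' n : Site (3 + 1),
            ((1 / 2 : ℝ) • (T2RecOf 3 (Lc ^ (j + 1)) (fun _ => compChart R.rc Lc (j + 1) (R.s (j + 1)) (Lc ^ (j + 1)))
        (SpureRecOf 3 (Lc ^ (j + 1)) (tabsCompG (j + 1) (one_le_of_neZero Lc) R.hr (P.cM (j + 1))).V
        (tabsCompG (j + 1) (one_le_of_neZero Lc) R.hr (P.cM (j + 1))).H (fun _ => compChart R.rc Lc (j + 1) (R.s (j + 1)) (Lc ^ (j + 1)))
        (P.cE (j + 1)) (P.cVH (j + 1)) (P.cΛ (j + 1)))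
        (tabsCompG (j + 1) (one_le_of_neZero Lc) R.hr (P.cM (j + 1))).M (P.cE₂ (j + 1)) (P.cB (j + 1)) (P.T (j + 1))
        (tabsCompG (j + 1) (one_le_of_neZero Lc) R.hr (P.cM (j + 1))).vh₂S (tabsCompG (j + 1) (one_le_of_neZero Lc) R.hr (P.cM (j + 1))).mixFF 0 κ u κ' (translate M u' n)
          + sgnK (trK (T2RecOf 3 (Lc ^ (j + 1)) (fun _ => compChart R.rc Lc (j + 1) (R.s (j + 1)) (Lc ^ (j + 1)))
        (SpureRecOf 3 (Lc ^ (j + 1)) (tabsCompG (j + 1) (one_le_of_neZero Lc) R.hr (P.cM (j + 1))).V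
        (tabsCompG (j + 1) (one_le_of_neZero Lc) R.hr (P.cM (j + 1))).H (fun _ => compChart R.rc Lc (j + 1) (R.s (j + 1)) (Lc ^ (j + 1)))
        (P.cE (j + 1)) (P.cVH (j + 1)) (P.cΛ (j + 1)))
        (tabsCompG (j + 1) (one_le_of_neZero Lc) R.hr (P.cM (j + 1))).M (P.cE₂ (j + 1)) (P.cB (j + 1)) (P.T (j + 1))
        (tabsCompG (j + 1) (one_le_of_neZero Lc) R.hr (P.cM (j + 1))).vh₂S (tabsCompG (j + 1) (one_le_of_neZero Lc) R.hr (P.cM (j + 1))).mixFF 0 κ u κ' (translate M u' n))))) x z a c) x w (Sum.inl α) (Sum.inl β)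
        = ((P.cE₂ (j + 1)) • fun x z a c => ∑' n : Site (3 + 1),
            ((1 / 2 : ℝ) • (wilsonW₂ 3 (P.T (j + 1)) κ u κ' (translate M u' n) + sgnK (trK (wilsonW₂ 3 (P.T (j + 1)) κ u κ' (translate M u' n))))) x z a c) x w (Sum.inl α) (Sum.inl β) := fun x w => by
    simp only [Pi.smul_apply, smul_eq_mul]
    rw [← tsum_mul_left]
    exact tsum_congr fun n => T2NG_even_apply_inl_inl R P j κ u κ' (translate M u' n) x w α β
  rw [perF_dper_apply_congr_entry M hY, dper_smul, perF_smul, Matrix.smul_apply, smul_eq_mul]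

section WithM'

variable [∀ μ, NeZero (M' μ)]

/-- [folklore] **`perF_dper_wound_WNG_evenHalf_inl_inl_eq_sum` — THE WOUND EVEN N-FAMILY's TORUS MATRIX ON THE FIELD–FIELD BLOCK** (`M = Lc^(j+1)·M′`; v5's `hHN₂` right side
per box at `M := towerTorus …`, `M′ := Mc B`, `j := n+1`): `perF M (dper M (x w ↦ Σ'_e WN♮ μ y ν (y′+M′∘e) x w)) (p, inl α) (q, inl β)
= cE₂ · ½(Σ_{u,κ} Σ_{u′,κ′} Θ(u,κ;μ,y)·(Θ(u′,κ′;ν,y′)·Ŵ₂ᵉ(κ,u,κ′,u′)) + Σ Θ(u,κ;ν,y′)·(Θ(u′,κ′;μ,y)·Ŵ₂ᵉ(κ,u,κ′,u′)))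
  + (Σ_{u,κ} Σ_{w,ρ} Θ(u,κ;μ,y)·(Ŝ(w,ρ;ν,y′)·ℳ̂₂ᵉ(κ,u,ρ,w)) + Σ Θ(u,κ;ν,y′)·(Ŝ(w,ρ;μ,y)·ℳ̂₂ᵉ(κ,u,ρ,w)))` at the entry `((p, inl α), (q, inl β))`,
`Ŵ₂ᵉ(κ,u,κ′,u′) := perF M (dper M (x z ↦ Σ'_n W₂ᵉ κ u κ′ (u′+M∘n) x z))`, `ℳ̂₂ᵉ(κ,u,ρ,w) := perF M (dper M (x z ↦ Σ'_n M2_Nᵉ κ u ρ (w+M′∘n) x z))` — THREE sectors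
(Wilson bi-vertex, two mixed), the `Θ`-columns road #6's `hJW`, the `Ŝ`-columns the road's `hJM` to display (A-5 (i)); NO response word, NO Λ-Hessian table, NO border table. -/
theorem perF_dper_wound_WNG_evenHalf_inl_inl_eq_sum (hM : ∀ i, M i = Lc ^ (j + 1) * M' i)
    (μ : Fin (3 + 1)) (y : Site (3 + 1)) (ν : Fin (3 + 1)) (y' : Site (3 + 1)) (p q : ↥(pbox M)) (α β : Fin (3 + 1)) :
    perF M (dper M (fun x w a b => ∑' e : Site (3 + 1),
        ((1 / 2 : ℝ) • ((WchartOf (fun _ => compChart R.rc Lc (j + 1) (R.s (j + 1)) (Lc ^ (j + 1))) (tabsCompG (j + 1) (one_le_of_neZero Lc) R.hr (P.cM (j + 1))) (P.cE (j + 1)) (P.cVH (j + 1)) (P.cΛ (j + 1)) (P.cE₂ (j + 1)) (P.cB (j + 1)) (P.T (j + 1)) 0) μ y ν (translate M' y' e) + sgnK (trK ((WchartOf (fun _ => compChart R.rc Lc (j + 1) (R.s (j + 1)) (Lc ^ (j + 1))) (tabsCompG (j + 1) (one_le_of_neZero Lc) R.hr (P.cM (j + 1))) (P.cE (j + 1))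 (P.cVH (j + 1)) (P.cΛ (j + 1)) (P.cE₂ (j + 1)) (P.cB (j + 1)) (P.T (j + 1)) 0) μ y ν (translate M' y' e))))) x w a b)) (p, Sum.inl α) (q, Sum.inl β)
      = P.cE₂ (j + 1) * ((1 / 2 : ℝ) * ((∑ u : ↥(pbox M), ∑ κ : Fin (3 + 1), ∑ u' : ↥(pbox M), ∑ κ' : Fin (3 + 1),
          perF M (AN R j) (u, Sum.inl κ) (wrapPt M (((Lc ^ (j + 1) : ℕ) : ℤ) • y), Sum.inr μ)
            * (perF M (AN R j) (u', Sum.inl κ') (wrapPt M (((Lc ^ (j + 1) : ℕ) : ℤ) • y'), Sum.inr ν)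
                * perF M (dper M (fun x z a c => ∑' n : Site (3 + 1),
            ((1 / 2 : ℝ) • (wilsonW₂ 3 (P.T (j + 1)) κ (u : Site (3 + 1)) κ' (translate M (u' : Site (3 + 1)) n) + sgnK (trK (wilsonW₂ 3 (P.T (j + 1)) κ (u : Site (3 + 1)) κ' (translate M (u' : Site (3 + 1)) n))))) x z a c)) (p, Sum.inl α) (q, Sum.inl β)))
          + (∑ u : ↥(pbox M), ∑ κ : Fin (3 + 1), ∑ u' : ↥(pbox M), ∑ κ' : Fin (3 + 1),
          perF M (AN R j) (u, Sum.inl κ) (wrapPt M (((Lc ^ (j + 1) : ℕ) : ℤ) • y'), Sum.inr ν)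
            * (perF M (AN R j) (u', Sum.inl κ') (wrapPt M (((Lc ^ (j + 1) : ℕ) : ℤ) • y), Sum.inr μ)
                * perF M (dper M (fun x z a c => ∑' n : Site (3 + 1),
            ((1 / 2 : ℝ) • (wilsonW₂ 3 (P.T (j + 1)) κ (u : Site (3 + 1)) κ' (translate M (u' : Site (3 + 1)) n) + sgnK (trK (wilsonW₂ 3 (P.T (j + 1)) κ (u : Site (3 + 1)) κ' (translate M (u' : Site (3 + 1)) n))))) x z a c)) (p, Sum.inl α) (q, Sum.inl β)))))
        + ((∑ u : ↥(pbox M), ∑ κ : Fin (3 + 1), ∑ w : ↥(pbox M'), ∑ ρ : Fin (3 + 1),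
          perF M (AN R j) (u, Sum.inl κ) (wrapPt M (((Lc ^ (j + 1) : ℕ) : ℤ) • y), Sum.inr μ)
            * (perF M (AN R j) (wrapPt M (((Lc ^ (j + 1) : ℕ) : ℤ) • (w : Site (3 + 1))), Sum.inr ρ) (wrapPt M (((Lc ^ (j + 1) : ℕ) : ℤ) • y'), Sum.inr ν)
                * perF M (dper M (fun x z a c => ∑' n : Site (3 + 1),
            ((1 / 2 : ℝ) • (M2Of 3 (Lc ^ (j + 1)) (tabsCompG (j + 1) (one_le_of_neZero Lc) R.hr (P.cM (j + 1))).mixFF 0 κ (u : Site (3 + 1)) ρ (translate M' (w : Site (3 + 1)) n) + sgnK (trK (M2Of 3 (Lc ^ (j + 1)) (tabsCompG (j + 1) (one_le_of_neZero Lc) R.hr (P.cM (j + 1))).mixFF 0 κ (u : Site (3 + 1)) ρ (translate M' (w : Site (3 + 1)) n))))) x z a c)) (p, Sum.inl α) (q, Sum.inl β)))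
          + (∑ u : ↥(pbox M), ∑ κ : Fin (3 + 1), ∑ w : ↥(pbox M'), ∑ ρ : Fin (3 + 1),
          perF M (AN R j) (u, Sum.inl κ) (wrapPt M (((Lc ^ (j + 1) : ℕ) : ℤ) • y'), Sum.inr ν)
            * (perF M (AN R j) (wrapPt M (((Lc ^ (j + 1) : ℕ) : ℤ) • (w : Site (3 + 1))), Sum.inr ρ) (wrapPt M (((Lc ^ (j + 1) : ℕ) : ℤ) • y), Sum.inr μ)
                * perF M (dper M (fun x z a c => ∑' n : Site (3 + 1),
            ((1 / 2 : ℝ) • (M2Of 3 (Lc ^ (j + 1)) (tabsCompG (j + 1) (one_le_of_neZero Lc) R.hr (P.cM (j + 1))).mixFF 0 κ (u : Site (3 + 1)) ρ (translate M' (w : Site (3 + 1)) n) + sgnK (trK (M2Of 3 (Lc ^ (j + 1)) (tabsCompG (j + 1) (one_le_of_neZero Lc) R.hr (P.cM (j + 1))).mixFF 0 κ (u : Site (3 + 1)) ρ (translate M' (w : Site (3 + 1)) n))))) x z a c)) (p, Sum.inl α) (q, Sum.inl β)))) := by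
  rw [perF_dper_tsum_WNG_evenHalf R P j M hM, perF_W2SymOfK_NG_even R P j M hM, Matrix.smul_apply, Matrix.add_apply,
    perF_W2OfK_NG_even R P j M hM μ y ν y', perF_W2OfK_NG_even R P j M hM ν y' μ y, Matrix.add_apply, Matrix.add_apply, Matrix.add_apply, Matrix.add_apply,
    perF_vertex2OfK_NG_even R P j M hM μ y ν y', perF_vertex2OfK_NG_even R P j M hM ν y' μ y,
    perF_mixOfK_NG_even R P j M hM μ y ν y', perF_mixOfK_NG_even R P j M hM ν y' μ y, smul_eq_mul]
  simp only [perF_T2NG_even_per_inl_inl]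
  rw [sum₄_mul_pull, sum₄_mul_pull]
  ring

end WithM'


/-! ## §5 The same reading AT THE (F0) TABLE NAME `compMixG` (gen 85 append) -/

section WithM'G

variable [∀ μ, NeZero (M' μ)]

open Summit.QuantumFields.BalabanUV.Beta.CompositeMixedTableGraded (compMixG)
open Summit.QuantumFields.BalabanUV.Beta.CompositeOneShotJetsGraded (tabsCompG_mixFF)

/-- [folklore] **`perF_dper_wound_WNG_evenHalf_inl_inl_eq_sum_compMixG` — §4 WITH THE MIXED TABLE SPELLED `compMixG R.r Lc (j+1)`** (PART 92 `tabsCompG_mixFF` by `rfl`):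
the token the road's B5 graded door twins (`TowerHN2RowGraded ∕ TowerHN2RowDoorGraded`) and v11's `hM₂′` text carry — (F0)'s graded composite mixed table BY NAME instead of the record
projection `(tabsCompG …).mixFF`; nothing else changes (row D1, an2 gen 85; also re-verifies this module on the gate lane — INFRA-2, E-FP-61-3). -/
theorem perF_dper_wound_WNG_evenHalf_inl_inl_eq_sum_compMixG (hM : ∀ i, M i = Lc ^ (j + 1) * M' i)
    (μ : Fin (3 + 1)) (y : Site (3 + 1)) (ν : Fin (3 + 1)) (y' : Site (3 + 1)) (p q : ↥(pbox M)) (α β : Fin (3 + 1)) :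
    perF M (dper M (fun x w a b => ∑' e : Site (3 + 1),
        ((1 / 2 : ℝ) • ((WchartOf (fun _ => compChart R.rc Lc (j + 1) (R.s (j + 1)) (Lc ^ (j + 1))) (tabsCompG (j + 1) (one_le_of_neZero Lc) R.hr (P.cM (j + 1))) (P.cE (j + 1)) (P.cVH (j + 1)) (P.cΛ (j + 1)) (P.cE₂ (j + 1)) (P.cB (j + 1)) (P.T (j + 1)) 0) μ y ν (translate M' y' e) + sgnK (trK ((WchartOf (fun _ => compChart R.rc Lc (j + 1) (R.s (j + 1)) (Lc ^ (j + 1))) (tabsCompG (j + 1) (one_le_of_neZero Lc) R.hr (P.cM (j + 1))) (P.cE (j + 1)) (P.cVH (j + 1)) (P.cΛ (j + 1)) (P.cE₂ (j + 1)) (P.cB (j + 1)) (P.T (j + 1)) 0) μ y ν (translate M' y' e))))) x w a b)) (p, Sum.inl α) (q, Sum.inl β)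
      = P.cE₂ (j + 1) * ((1 / 2 : ℝ) * ((∑ u : ↥(pbox M), ∑ κ : Fin (3 + 1), ∑ u' : ↥(pbox M), ∑ κ' : Fin (3 + 1),
          perF M (AN R j) (u, Sum.inl κ) (wrapPt M (((Lc ^ (j + 1) : ℕ) : ℤ) • y), Sum.inr μ)
            * (perF M (AN R j) (u', Sum.inl κ') (wrapPt M (((Lc ^ (j + 1) : ℕ) : ℤ) • y'), Sum.inr ν)
                * perF M (dper M (fun x z a c => ∑' n : Site (3 + 1),
            ((1 / 2 : ℝ) • (wilsonW₂ 3 (P.T (j + 1)) κ (u : Site (3 + 1)) κ' (translate M (u' : Site (3 + 1)) n) + sgnK (trK (wilsonW₂ 3 (P.T (j + 1)) κ (u : Site (3 + 1)) κ' (translate M (u' : Site (3 + 1)) n))))) x z a c)) (p, Sum.inl α) (q, Sum.inl β)))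
          + (∑ u : ↥(pbox M), ∑ κ : Fin (3 + 1), ∑ u' : ↥(pbox M), ∑ κ' : Fin (3 + 1),
          perF M (AN R j) (u, Sum.inl κ) (wrapPt M (((Lc ^ (j + 1) : ℕ) : ℤ) • y'), Sum.inr ν)
            * (perF M (AN R j) (u', Sum.inl κ') (wrapPt M (((Lc ^ (j + 1) : ℕ) : ℤ) • y), Sum.inr μ)
                * perF M (dper M (fun x z a c => ∑' n : Site (3 + 1),
            ((1 / 2 : ℝ) • (wilsonW₂ 3 (P.T (j + 1)) κ (u : Site (3 + 1)) κ' (translate M (u' : Site (3 + 1)) n) + sgnK (trK (wilsonW₂ 3 (P.T (j + 1)) κ (u : Site (3 + 1)) κ' (translate M (u' : Site (3 + 1)) n))))) x z a c)) (p, Sum.inl α) (q, Sum.inl β)))))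
        + ((∑ u : ↥(pbox M), ∑ κ : Fin (3 + 1), ∑ w : ↥(pbox M'), ∑ ρ : Fin (3 + 1),
          perF M (AN R j) (u, Sum.inl κ) (wrapPt M (((Lc ^ (j + 1) : ℕ) : ℤ) • y), Sum.inr μ)
            * (perF M (AN R j) (wrapPt M (((Lc ^ (j + 1) : ℕ) : ℤ) • (w : Site (3 + 1))), Sum.inr ρ) (wrapPt M (((Lc ^ (j + 1) : ℕ) : ℤ) • y'), Sum.inr ν)
                * perF M (dper M (fun x z a c => ∑' n : Site (3 + 1),
            ((1 / 2 : ℝ) • (M2Of 3 (Lc ^ (j + 1)) (compMixG R.r Lc (j + 1)) 0 κ (u : Site (3 + 1)) ρ (translate M' (w : Site (3 + 1)) n) + sgnK (trK (M2Of 3 (Lc ^ (j + 1)) (compMixG R.r Lc (j + 1)) 0 κ (u : Site (3 + 1)) ρ (translate M' (w : Site (3 + 1)) n))))) x z a c)) (p, Sum.inl α) (q, Sum.inl β)))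
          + (∑ u : ↥(pbox M), ∑ κ : Fin (3 + 1), ∑ w : ↥(pbox M'), ∑ ρ : Fin (3 + 1),
          perF M (AN R j) (u, Sum.inl κ) (wrapPt M (((Lc ^ (j + 1) : ℕ) : ℤ) • y'), Sum.inr ν)
            * (perF M (AN R j) (wrapPt M (((Lc ^ (j + 1) : ℕ) : ℤ) • (w : Site (3 + 1))), Sum.inr ρ) (wrapPt M (((Lc ^ (j + 1) : ℕ) : ℤ) • y), Sum.inr μ)
                * perF M (dper M (fun x z a c => ∑' n : Site (3 + 1),
            ((1 / 2 : ℝ) • (M2Of 3 (Lc ^ (j + 1)) (compMixG R.r Lc (j + 1)) 0 κ (u : Site (3 + 1)) ρ (translate M' (w : Site (3 + 1)) n) + sgnK (trK (M2Of 3 (Lc ^ (j + 1)) (compMixG R.r Lc (j + 1)) 0 κ (u : Site (3 + 1)) ρ (translate M' (w : Site (3 + 1)) n))))) x z a c)) (p, Sum.inl α) (q, Sum.inl β)))) := by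
  have h := perF_dper_wound_WNG_evenHalf_inl_inl_eq_sum R P j M hM μ y ν y' p q α β
  rw [tabsCompG_mixFF] at h
  exact h

end WithM'G

end Summit.QuantumFields.BalabanUV.Beta.NVertexGradedRecord
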